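import Summits.AtomisticToContinuum.HydrodynamicLimit.Theses.LindebergRandomFuture
import Summits.AtomisticToContinuum.HydrodynamicLimit.Theorems.LambertianContactSwapLambertianEulerOfHearts
import Summits.AtomisticToContinuum.HydrodynamicLimit.Theses.LambertianContactSwap
import Summits.AtomisticToContinuum.HydrodynamicLimit.Theorems.LambertianContactSwapLambertianEulerArchimedes
import Summits.AtomisticToContinuum.HydrodynamicLimit.Theorems.LambertianContactSwapLambertianEulerLambertLaw
import Summits.AtomisticToContinuum.HydrodynamicLimit.Theorems.LambertianContactSwapLambertianEulerPovzner
import Summits.AtomisticToContinuum.HydrodynamicLimit.Theorems.LambertianContactSwapLambertianEulerPairPovzner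
import Summits.AtomisticToContinuum.HydrodynamicLimit.Theorems.LambertianContactSwapLambertianEulerContactIsotropy
import Summits.AtomisticToContinuum.HydrodynamicLimit.Theorems.LambertianContactSwapLambertianEulerMomentLedgerChain
import Summits.AtomisticToContinuum.HydrodynamicLimit.Theorems.LambertianContactSwapLambertianEulerGibbsInvariance
import Summits.AtomisticToContinuum.HydrodynamicLimit.Theorems.LambertianContactSwapLambertianEulerEntropyToHydro
import Summits.AtomisticToContinuum.HydrodynamicLimit.Theorems.LambertianContactSwapLambertianEulerWindow
import Summits.AtomisticToContinuum.HydrodynamicLimit.Theorems.LambertianContactSwapLambertianEulerMarkov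
import Summits.AtomisticToContinuum.HydrodynamicLimit.Theorems.LambertianContactSwapLambertianEulerIterate
import Summits.AtomisticToContinuum.HydrodynamicLimit.Theorems.LambertianContactSwapLambertianEulerDock
import Summits.AtomisticToContinuum.HydrodynamicLimit.Theorems.LambertianContactSwapLambertianEulerKlLedger
import Summits.AtomisticToContinuum.HydrodynamicLimit.Theorems.LambertianContactSwapLambertianEulerLawSemigroup
import Summits.AtomisticToContinuum.HydrodynamicLimit.Theorems.LambertianContactSwapLambertianEulerDockRf
import Summits.AtomisticToContinuum.HydrodynamicLimit.Theorems.LambertianContactSwapLambertianEulerLambertDirMean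
import Summits.AtomisticToContinuum.HydrodynamicLimit.Theorems.LambertianContactSwapLambertianEulerPairMeanSq
import Summits.AtomisticToContinuum.HydrodynamicLimit.Theorems.LambertianContactSwapLambertianEulerPathwiseProduction
import Summits.AtomisticToContinuum.HydrodynamicLimit.Theorems.LambertianContactSwapLambertianEulerWindowLedger
import Summits.AtomisticToContinuum.HydrodynamicLimit.Theorems.LambertianContactSwapLambertianEulerCollisionCompensator
import Summits.AtomisticToContinuum.HydrodynamicLimit.Theorems.LambertianContactSwapLambertianEulerCompensatedJump
import Summits.AtomisticToContinuum.HydrodynamicLimit.Theorems.LambertianContactSwapLambertianEulerAprioriEntropyBound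
import Summits.AtomisticToContinuum.HydrodynamicLimit.Theorems.LambertianContactSwapLambertianEulerCollisionIntensity
import Summits.AtomisticToContinuum.HydrodynamicLimit.Theorems.LambertianContactSwapLambertianEulerTwoTimeLaw
import Summits.AtomisticToContinuum.HydrodynamicLimit.Theorems.LambertianContactSwapLambertianEulerCollisionBudget
import Summits.AtomisticToContinuum.HydrodynamicLimit.Theorems.LambertianContactSwapLambertianEulerExpectedWindowProductionTools
import Summits.AtomisticToContinuum.HydrodynamicLimit.Theorems.LambertianContactSwapLambertianEulerExpectedWindowProduction
import Summits.AtomisticToContinuum.HydrodynamicLimit.Theorems.LambertianContactSwapLambertianEulerProductionSplit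
import Summits.AtomisticToContinuum.HydrodynamicLimit.Theorems.TwoClocksClampedEntropyClockTimeZeroReference
import Summits.AtomisticToContinuum.HydrodynamicLimit.Theorems.TwoClocksClampedEntropyClockDiscreteEntropyGronwall
import Summits.AtomisticToContinuum.HydrodynamicLimit.Theorems.TwoClocksClampedEntropyClockKlDivLawAtLocalGibbsNeTop
import Literature.MathematicalPhysics.KineticTheory.LambertianRedrawNondegenerate
import Literature.MathematicalPhysics.KineticTheory.Hilbert6Wave0Proofs
import Literature.MathematicalPhysics.KineticTheory.HardSphereEulerLLN
import Literature.Barriers.AtomisticToContinuum.HighMomentumCutoff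
import Literature.Analysis.FluidPDE.HardSphereAlexander
import HarnessLib

/-! TTRL-lite variant V4542 of stmt-AtomisticToContinuum-11854

The variant drops the hypothesis `∀ x, 0 < θ₀ x` from `stub_diluteSelfConsistency`. It is FALSE:
with the zero temperature profile `θ₀ ≡ 0` the local Maxwellian `(2π·0)^{-3/2} exp(…)` is the junk
value `0`, so every local Gibbs law `localGibbsLaw σ a₀ u₀ 0 N Φ` is the zero measure and the
`t = 0` law-of-large-numbers tie `TendstoHydroFieldsAt … 0` holds for ANY macroscopic fields. The
constant hard-sphere-Euler state `ρ ≡ σ⁻³, u ≡ 0, θ ≡ 1` (a classical solution on `[0, 1)` for every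
`σ`) then has packing `ρ σ³ = 1`, contradicting the conclusion with `η = 1`. Hard-sphere flows of
diameter `hsDiameter σ N ≤ σ < 1/2` exist by Alexander's theorem on the torus.
-/

namespace Summit.AtomisticToContinuum.HydrodynamicLimit.Theorems

open scoped BigOperators Topology ENNReal InnerProductSpace
open MeasureTheory ProbabilityTheory Filter Set InformationTheory
open Literature.MathematicalPhysics.KineticTheory
open Literature.Analysis.FluidPDE Literature.Analysis.FluidPDE.Alexander
open Summit.AtomisticToContinuum.HydrodynamicLimit.Theses.LambertianContactSwap
open Summit.AtomisticToContinuum.HydrodynamicLimit.Theorems.ClampedCurrentsDockPathwise (gSum DgSum)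

/-- With the zero temperature profile the local Maxwellian vanishes identically (junk value of
`0 ^ (-3/2)`). -/
theorem localMaxwellian_temp_zero_var4542 (u v : V3) :
    Literature.Analysis.FluidPDE.localMaxwellian 1 0 u v = 0 := by
  have h3 : (Module.finrank ℝ V3 : ℝ) = 3 := by
    rw [finrank_euclideanSpace_fin]; norm_num
  simp only [Literature.Analysis.FluidPDE.localMaxwellian, mul_zero, h3]
  rw [Real.zero_rpow (by norm_num)]
  simp

/-- With the zero temperature profile the local Gibbs law is the zero measure. -/
theorem localGibbsLaw_temp_zero_var4542 (σ : ℝ) (a₀ : T3 → ℝ) (u₀ : T3 → V3) (N : ℕ)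
    (Φ : HardSphereFlow (Torus.geometry (Fin 3)) (hsDiameter σ N) (N + 1)) :
    localGibbsLaw σ a₀ u₀ (fun _ => 0) N Φ = 0 := by
  have hprof : localGibbsProfile a₀ u₀ (fun _ => (0 : ℝ)) = fun _ => 0 := by
    funext y
    simp [localGibbsProfile, localMaxwellian_temp_zero_var4542]
  have hdens : ∀ z, Literature.Analysis.FluidPDE.canonicalDensity (Torus.geometry (Fin 3))
      (hsDiameter σ N) (N + 1) (localGibbsProfile a₀ u₀ (fun _ => (0 : ℝ))) z = 0 := by
    intro z
    have htp : Literature.Analysis.FluidPDE.tensorPow (N + 1) (fun _ : T3 × V3 => (0 : ℝ)) =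
        fun _ => 0 := by
      funext Z
      simp [Literature.Analysis.FluidPDE.tensorPow]
    simp [Literature.Analysis.FluidPDE.canonicalDensity, hprof, htp]
  rw [localGibbsLaw, Literature.Analysis.FluidPDE.particleLaw_eq]
  simp only [hdens, ENNReal.ofReal_zero]
  exact withDensity_zero

/-- TTRL-lite variant V4542 of `stub_diluteSelfConsistency` (hypothesis `∀ x, 0 < θ₀ x` dropped)
is FALSE: witness `η = 1`, `a₀ ≡ 1`, `θ₀ ≡ 0`, `u₀ ≡ 0`, `σ = min (σ₀/2) (1/4)`, the constant
Euler state `(σ⁻³, 0, 1)` on `[0, 1)`, Alexander flows, `t = 0`. -/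
theorem stub_diluteSelfConsistency_var4542_false : ¬ (∀ η : ℝ, 0 < η → ∀ (a₀ θ₀ : T3 → ℝ) (u₀ : T3 → V3), Continuous a₀ → Continuous θ₀ → Continuous u₀ → (∀ x, 0 < a₀ x) → ∃ σ₀ : ℝ, 0 < σ₀ ∧ ∀ σ : ℝ, 0 < σ → σ < σ₀ → ∀ (T : ℝ) (ρ θ : ℝ → T3 → ℝ) (u : ℝ → T3 → V3), IsHardSphereEulerSolution σ T ρ u θ → ∀ Φ : (N : ℕ) → HardSphereFlow (Torus.geometry (Fin 3)) (hsDiameter σ N) (N + 1), TendstoHydroFieldsAt (fun N => localGibbsLaw σ a₀ u₀ θ₀ N (Φ N)) Φ ρ u θ 0 → ∀ t ∈ Set.Ico 0 T, ∀ x, ρ t x * σ ^ 3 < η) := by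
  intro h
  obtain ⟨σ₀, hσ₀, hσ⟩ := h 1 one_pos (fun _ => 1) (fun _ => 0) (fun _ => 0) continuous_const
    continuous_const continuous_const (fun _ => one_pos)
  set σ : ℝ := min (σ₀ / 2) (1 / 4) with hσdef
  have hσpos : 0 < σ := lt_min (by positivity) (by norm_num)
  have hσlt : σ < σ₀ := lt_of_le_of_lt (min_le_left _ _) (by linarith)
  have hσhalf : σ < 2⁻¹ := lt_of_le_of_lt (min_le_right _ _) (by norm_num)
  -- Alexander: hard-sphere flows of diameter `hsDiameter σ N ≤ σ < 1/2` exist.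
  have hΦ : ∀ N : ℕ, Nonempty (HardSphereFlow (Torus.geometry (Fin 3)) (hsDiameter σ N) (N + 1)) :=
    fun N => HardSphereFlow.nonempty_torus_holds (hsDiameter_pos hσpos N)
      (lt_of_le_of_lt (hsDiameter_le hσpos.le N) hσhalf) (N + 1)
  let Φ : (N : ℕ) → HardSphereFlow (Torus.geometry (Fin 3)) (hsDiameter σ N) (N + 1) :=
    fun N => (hΦ N).some
  -- the constant Euler state of density `σ⁻³`
  have hc : 0 < (σ ^ 3)⁻¹ := inv_pos.2 (pow_pos hσpos 3)
  have hsol : IsHardSphereEulerSolution σ 1 (fun _ _ => (σ ^ 3)⁻¹) (fun _ _ => (0 : V3))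
      (fun _ _ => 1) :=
    isHardSphereEulerSolutionDim_three_iff.1 (IsHardSphereEulerSolutionDim.const σ 1 (0 : V3) hc one_pos)
  -- the tie is vacuous: the law is zero
  have htend : TendstoHydroFieldsAt (fun N => localGibbsLaw σ (fun _ => (1 : ℝ)) (fun _ => (0 : V3))
      (fun _ => (0 : ℝ)) N (Φ N)) Φ (fun _ _ => (σ ^ 3)⁻¹) (fun _ _ => (0 : V3)) (fun _ _ => 1) 0 := by
    intro χ _ δ _
    simp only [localGibbsLaw_temp_zero_var4542, Measure.coe_zero, Pi.zero_apply]
    exact ⟨tendsto_const_nhds, tendsto_const_nhds, tendsto_const_nhds⟩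
  have key := hσ σ hσpos hσlt 1 _ _ _ hsol Φ htend 0 ⟨le_rfl, one_pos⟩ 0
  rw [inv_mul_cancel₀ (pow_pos hσpos 3).ne'] at key
  exact lt_irrefl _ key

end Summit.AtomisticToContinuum.HydrodynamicLimit.Theorems
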